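import Mathlib
import Summits.QuantumFields.BalabanUV.Beta.FP.PerfectFFBlockRowDiffTorus
import Summits.QuantumFields.BalabanUV.Beta.FP.PerfectFFBlockRowSum

/-!
# `BalabanUV.Beta.FP.PerfectFFBlockRowDiff` — road «FP» (binder row D1), lane IR-5′, **THE (T1′) SOCKET, FILE F5b (LIMIT SIDE): THE COLUMN-DIFFERENCE
# Γ-LETTER OF THE (R1) GAUGE TERM FROM ONE DISPLAYED TOWER LETTER** — for odd `Lc > 1`,
# `Σ_{q∈Q} |KPerf … m q (w+e_μ) ff − KPerf … m q w ff| ≤ (C₁∕2)·Lc^m` for every `m ≥ 1`, finite `Q ⊂ ℤ⁴`, `w μ κ l` (RHOA-3's `hT1` shape, `T₁ ≍ n`,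
# `n = Lc^m`) ⟸ the GRADIENT row-sum letter of the hard covariance on the tower tori, `Σ_j ‖𝒞(i+ê_μ) j − 𝒞 i j‖ ≤ C₁∕N` (`N = nP P = Lc^K` fine steps per unit)
# — our bookkeeping: F5a's torus bound (`PerfectFFBlockRowDiffTorus`) de-periodised and passed to `j → ∞` exactly as F4b (`PerfectFFBlockRowSum`) does for (T0′);
# the letter `C₁` is a HYPOTHESIS displayed in every signature (no estimate of Bałaban's objects is proved here)

HONEST DEPENDENCY (page 1, mandatory): continuum YM on T⁴ ⇐ BetaPertH ∧ nine spine estimates (0/9 proved); BetaPertH ⇐ (D1) ∧ (D4) ∧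
CAP+tail; G-an2-4 gates asym, D1 and NE2/3/4.  HONEST FRAMING (cell contract, verbatim): «discharging `BetaPertH` makes Bałaban's UV
stability UNCONDITIONAL — a real constructive-QFT result; it is NOT the continuum limit and NOT the Clay problem.»  THIS MODULE is bookkeeping BY NAME over
F5a, F4b's de-periodisation (`sum_abs_le_of_periodisations`), g17's summability (`summable_unitK_KTot_ff`), gan24's `tendsto_KTot_KPerf_holds` and F4b's
`KPerf_ff_symm`; it cites nothing, mints no `Prop`, has no `def`, 0 sorry.  WHAT IT IS NOT: NOT the tower letter `C₁` = (1.115)'s SECOND entry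
«|∇GJ| ≤ O(1)|J|» (B5 = Bałaban, CMP 95 (1984) p. 36) for the HARD covariance `𝒞 = G − ∂Δ⁻¹RΔ⁻¹∂ᴴ − GQ*(QGQ*)⁻¹QG` in row-sum currency — its suppliers
((1.115)'s second entry for the VECTOR `G = Δ_1⁻¹` — in the tree on CUBIC tori, t4-ne3-p1's `SliceFlatGradient` transported by t4-ne2-formalise-leaf-05's
`GradientRowSumTransport`, assembled in F5e `CovarianceRowDiffTower` — and a log-free gradient row-sum bound for the COMPOSITE gauge factor `∂Δ⁻¹RΔ⁻¹∂ᴴ`, NOT in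
the tree) are NOT attempted here and (T1′) stays CONDITIONAL on the tower letter; NOT hslice, NOT (ASYMP), NOT D1, NOT BetaPertH, NOT continuum, NOT Clay.

ABSOLUTE RULE (cell charter, verbatim): «No internally-minted statement may enter as a cited fact. Every hypothesis is either kernel-proved in this
package or a verbatim quotation of a PUBLISHED theorem with page reference. The manuscript(s) under audit are NOT citable for their own disputed
steps — they are the thing under adjudication; programme-internal (2001/route/tribunal) claims are never citable.»

UNITS (F5a at `d = 3`, `Mb = Lc^j`, `N = Lc^(j+m)`, `n = Lc^m`, letter `C₁∕N`): `(Lc^j)²·(Lc^(j+m))²∕2 · (Lc^j)^{−5} · Lc^j · Lc^j · C₁∕Lc^(j+m) = (C₁∕2)·Lc^m`,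
uniformly in `j` — one power of `n` less than (T0′)'s `(C∕2)·(Lc^m)²`, as the (R1) power count wants (`FF-LEG-LETTERS.md` v2 §4).

CONTENT.  §1 [folklore] `summable_unitK_KTot_ff_pshift` (the shifted family is summable in the shift), `tsum_rowDiff_pshift_eq` (periodisation of the row
difference = difference of the periodisations); §2 **`sum_abs_unitK_KTot_ff_rowDiff_le`** (every finite `(j, m)` on the tower volumes, from F5a + §1 + F4b §1);
§3 the road (`d = 3`): **`sum_abs_KPerf_ff_rowDiff_le`** (row form), **`sum_abs_KPerf_ff_colDiff_le`** (column form = RHOA-3's `hT1` for `v = e_μ`, via `KPerf_ff_symm`),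
both `∀ m ≥ 1` with the ONE constant `C₁∕2`, CONDITIONAL on the displayed tower letter.
Unit `b2b-balaban-beta-d1-formalise-leaf-05` (gen 22), 2026-08-21; `LEAVES-FP.md` row «(T1′) SOCKET F5b».  «not in print; our bookkeeping».
-/

noncomputable section

open scoped BigOperators Matrix ComplexConjugate
open Filter Topology

namespace Summit.QuantumFields.BalabanUV.Beta.FP.PerfectFFBlockRowDiff

open Matrix
open Literature.MathematicalPhysics.QuantumFieldTheory.Balaban1983to89
open Literature.MathematicalPhysics.QuantumFieldTheory.Balaban1983to89.Beta
open AffineAveraging (Site)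
open B5Prop11Plancherel (Tor fine)
open FluctuationProjection (Cov)
open OneStepResolventKernel (Fib)
open OneStepKernelFamily (LegIdx legW)
open Summit.QuantumFields.BalabanUV.Beta.HessKerDressedUnits (unitK)
open Summit.QuantumFields.BalabanUV.Beta.GAN24.TorusPeriodise (pshift pshift_injective)
open Summit.QuantumFields.BalabanUV.Beta.GAN24.CombesThomas (sfStep smStep)
open Summit.QuantumFields.BalabanUV.Beta.GAN24.RealRateKMHolds (tendsto_KTot_KPerf_holds)
open Summit.QuantumFields.BalabanUV.Beta.FP.PerfectObjects (KTot)
open Summit.QuantumFields.BalabanUV.Beta.FP.PerfectObjectsT (KPerf)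
open Summit.QuantumFields.BalabanUV.Beta.FP.PerfectFFBlockBounded (summable_unitK_KTot_ff)
open Summit.QuantumFields.BalabanUV.Beta.FP.PerfectFFBlockRowSum (sum_abs_le_of_periodisations KPerf_ff_symm)
open Summit.QuantumFields.BalabanUV.Beta.FP.PerfectFFBlockRowDiffTorus (sum_abs_tsum_unitK_KTot_ff_pshift_rowDiff_le)
open B5SiteBridgeP12 (nP MP one_le_nP)

/-! ## §1 The periodisation of a row difference is the difference of the periodisations -/

section Periodise

variable {d : ℕ} (N : ℕ) [NeZero N] (Mb : ℕ)

/-- [folklore] the ff block is summable along every period lattice (`P_ν ≥ 1`) in its column variable. -/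
theorem summable_unitK_KTot_ff_pshift (hMb : 1 ≤ Mb) {P : Fin (d + 1) → ℕ} (hP : ∀ ν, 1 ≤ P ν) (sf sm : ℝ) (x' y' : Site (d + 1))
    (κ l : Fin (d + 1)) :
    Summable (fun t : Site (d + 1) => unitK sf sm (KTot (d := d) N Mb) x' (y' + pshift P t) (Sum.inl κ) (Sum.inl l)) := by
  haveI : ∀ ν, NeZero (P ν) := fun ν => ⟨Nat.one_le_iff_ne_zero.mp (hP ν)⟩
  have hinj : Function.Injective (fun t : Site (d + 1) => y' + pshift P t) := fun t s h => pshift_injective P (add_left_cancel h)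
  exact (summable_unitK_KTot_ff N Mb hMb sf sm x' κ l).comp_injective hinj

/-- [folklore] **PERIODISATION OF THE ROW DIFFERENCE = DIFFERENCE OF THE PERIODISATIONS** (both families summable). -/
theorem tsum_rowDiff_pshift_eq (hMb : 1 ≤ Mb) {P : Fin (d + 1) → ℕ} (hP : ∀ ν, 1 ≤ P ν) (sf sm : ℝ) (x₁ x₂ y' : Site (d + 1))
    (κ l : Fin (d + 1)) :
    ∑' t : Site (d + 1), (unitK sf sm (KTot (d := d) N Mb) x₁ (y' + pshift P t) (Sum.inl κ) (Sum.inl l)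
        - unitK sf sm (KTot (d := d) N Mb) x₂ (y' + pshift P t) (Sum.inl κ) (Sum.inl l))
      = (∑' t : Site (d + 1), unitK sf sm (KTot (d := d) N Mb) x₁ (y' + pshift P t) (Sum.inl κ) (Sum.inl l))
        - ∑' t : Site (d + 1), unitK sf sm (KTot (d := d) N Mb) x₂ (y' + pshift P t) (Sum.inl κ) (Sum.inl l) :=
  (summable_unitK_KTot_ff_pshift N Mb hMb hP sf sm x₁ y' κ l).tsum_sub (summable_unitK_KTot_ff_pshift N Mb hMb hP sf sm x₂ y' κ l)

end Periodise

/-! ## §2 Every finite `(j, m)` on the tower volumes -/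

section Finite

variable {d : ℕ}
set_option maxHeartbeats 400000 in
/-- [our bookkeeping] **ROW DIFFERENCES OF THE ff BLOCK OF THE UNIT-RESCALED (j,m)-RESOLVENT**: for odd `Lc > 1`, `K = j + m ≥ 1` and the GRADIENT letter
`C₁∕N` of the hard covariance on the tower tori (`N = Lc^K`, `M_ν = 2Lc^k`): for every finite `Q`, `x′ μ κ l` and unit `sm`,
`Σ_{y′∈Q} |unitK (Lc^j) sm (KTot (Lc^K) (Lc^j)) (x′+e_μ) y′ ff − unitK … x′ y′ ff| ≤ ((Lc^j)²·(Lc^K)²∕2)·legW·Lc^j·Lc^j·(C₁∕Lc^K)` — F5a's torus bound on the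
tori `k → ∞`, de-periodised by F4b §1. -/
theorem sum_abs_unitK_KTot_ff_rowDiff_le {Lc : ℕ} (hLc : Odd Lc ∧ 1 < Lc) {C₁ : ℝ}
    (hC1 : ∀ P : Params, P.d = d + 1 → P.L = Lc → 1 ≤ P.K →
      ∀ (i : Tor (fine (nP P) (MP P)) × Fin P.d) (μ : Fin P.d),
        ∑ j, ‖Cov (nP P) (one_le_nP P) (MP P) 1 one_pos (i.1 + B5Prop11Plancherel.unitVec (fine (nP P) (MP P)) μ, i.2) j
          - Cov (nP P) (one_le_nP P) (MP P) 1 one_pos i j‖ ≤ C₁ / (nP P : ℝ))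
    (j m : ℕ) (hjm : 1 ≤ j + m) (sm : ℝ) (x' : Site (d + 1)) (μ κ l : Fin (d + 1)) (Q : Finset (Site (d + 1))) :
    haveI : NeZero (Lc ^ (j + m)) := ⟨pow_ne_zero _ (by have := hLc.2; omega)⟩
    ∑ y' ∈ Q, |unitK ((Lc ^ j : ℕ) : ℝ) sm (KTot (d := d) (Lc ^ (j + m)) (Lc ^ j)) (x' + AffineAveraging.unitVec μ) y' (Sum.inl κ) (Sum.inl l)
        - unitK ((Lc ^ j : ℕ) : ℝ) sm (KTot (d := d) (Lc ^ (j + m)) (Lc ^ j)) x' y' (Sum.inl κ) (Sum.inl l)|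
      ≤ (((Lc ^ j : ℕ) : ℝ) ^ 2 * ((Lc ^ (j + m) : ℕ) : ℝ) ^ 2 / 2) *
          (legW d (Lc ^ j) (Sum.inl l : Fib d) * ((Lc ^ j : ℕ) * ((Lc ^ j : ℕ) * (C₁ / ((Lc ^ (j + m) : ℕ) : ℝ))))) := by
  haveI : NeZero (Lc ^ (j + m)) := ⟨pow_ne_zero _ (by have := hLc.2; omega)⟩
  have hLc1 : 1 ≤ Lc := hLc.2.le
  have hMb : 1 ≤ Lc ^ j := Nat.one_le_pow _ _ hLc1
  have hn : 1 ≤ Lc ^ m := Nat.one_le_pow _ _ hLc1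
  -- the tower volumes `P k = ⟨d+1, Lc, k, j+m⟩`, coarse periods `Lc^m · 2Lc^k`
  let Pk : ℕ → Params := fun k => ⟨d + 1, Lc, k, j + m, Nat.succ_pos d, hLc⟩
  have hnP : ∀ k, nP (Pk k) = Lc ^ (j + m) := fun k => rfl
  let Pd : ℕ → Fin (d + 1) → ℕ := fun k => fine (Lc ^ m) (MP (Pk k))
  have hPd1 : ∀ k ν, 1 ≤ Pd k ν := fun k ν => by
    show 1 ≤ Lc ^ m * (2 * Lc ^ k)
    exact Nat.one_le_iff_ne_zero.mpr (Nat.mul_ne_zero (by positivity) (by positivity))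
  have hPgrow : ∀ R : ℕ, ∀ᶠ k in atTop, ∀ ν, R ≤ Pd k ν := fun R => by
    refine (eventually_ge_atTop R).mono fun k hk ν => ?_
    show R ≤ Lc ^ m * (2 * Lc ^ k)
    calc R ≤ k := hk
      _ ≤ Lc ^ k := (Nat.lt_pow_self hLc.2).le
      _ ≤ 2 * Lc ^ k := Nat.le_mul_of_pos_left _ two_pos
      _ ≤ Lc ^ m * (2 * Lc ^ k) := Nat.le_mul_of_pos_left _ (by positivity)
  -- separation of `Q` against the fine periods for all large `k`
  obtain ⟨R, hR⟩ : ∃ R : ℕ, ∀ y₁ ∈ Q, ∀ y₂ ∈ Q, ∀ ν, |y₁ ν - y₂ ν| ≤ R := by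
    classical
    refine ⟨Q.sup (fun y₁ => Q.sup fun y₂ => Finset.univ.sup fun ν => (y₁ ν - y₂ ν).natAbs), fun y₁ h₁ y₂ h₂ ν => ?_⟩
    have h1 : (y₁ ν - y₂ ν).natAbs ≤ Finset.univ.sup fun ν => (y₁ ν - y₂ ν).natAbs := Finset.le_sup (f := fun ν => (y₁ ν - y₂ ν).natAbs) (Finset.mem_univ ν)
    have h2 : (Finset.univ.sup fun ν => (y₁ ν - y₂ ν).natAbs) ≤ Q.sup fun y₂ => Finset.univ.sup fun ν => (y₁ ν - y₂ ν).natAbs :=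
      Finset.le_sup (f := fun y₂ => Finset.univ.sup fun ν => (y₁ ν - y₂ ν).natAbs) h₂
    have h3 : (Q.sup fun y₂ => Finset.univ.sup fun ν => (y₁ ν - y₂ ν).natAbs) ≤ Q.sup (fun y₁ => Q.sup fun y₂ => Finset.univ.sup fun ν => (y₁ ν - y₂ ν).natAbs) :=
      Finset.le_sup (f := fun y₁ => Q.sup fun y₂ => Finset.univ.sup fun ν => (y₁ ν - y₂ ν).natAbs) h₁
    have h4 : |y₁ ν - y₂ ν| = ((y₁ ν - y₂ ν).natAbs : ℤ) := (Int.natCast_natAbs _).symm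
    rw [h4]
    exact_mod_cast h1.trans (h2.trans h3)
  have hB : ∀ᶠ k in atTop, ∑ y' ∈ Q, |∑' t : Site (d + 1),
      (unitK ((Lc ^ j : ℕ) : ℝ) sm (KTot (d := d) (Lc ^ (j + m)) (Lc ^ j)) (x' + AffineAveraging.unitVec μ) (y' + pshift (Pd k) t) (Sum.inl κ) (Sum.inl l)
        - unitK ((Lc ^ j : ℕ) : ℝ) sm (KTot (d := d) (Lc ^ (j + m)) (Lc ^ j)) x' (y' + pshift (Pd k) t) (Sum.inl κ) (Sum.inl l))|
        ≤ (((Lc ^ j : ℕ) : ℝ) ^ 2 * ((Lc ^ (j + m) : ℕ) : ℝ) ^ 2 / 2) *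
          (legW d (Lc ^ j) (Sum.inl l : Fib d) * ((Lc ^ j : ℕ) * ((Lc ^ j : ℕ) * (C₁ / ((Lc ^ (j + m) : ℕ) : ℝ))))) := by
    refine (eventually_ge_atTop ((Lc ^ j) * R + Lc ^ j)).mono fun k hk => ?_
    have hsep : ∀ y₁ ∈ Q, ∀ y₂ ∈ Q, ∀ ν, ((Lc ^ j : ℕ) : ℤ) * |y₁ ν - y₂ ν| + (Lc ^ j : ℕ) ≤ fine (nP (Pk k)) (MP (Pk k)) ν := by
      intro y₁ h₁ y₂ h₂ ν
      have h1 := hR y₁ h₁ y₂ h₂ ν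
      have h2 : ((Lc ^ j : ℕ) : ℤ) * (R : ℤ) + ((Lc ^ j : ℕ) : ℤ) ≤ ((fine (nP (Pk k)) (MP (Pk k)) ν : ℕ) : ℤ) := by
        have : Lc ^ j * R + Lc ^ j ≤ fine (nP (Pk k)) (MP (Pk k)) ν := by
          show Lc ^ j * R + Lc ^ j ≤ Lc ^ (j + m) * (2 * Lc ^ k)
          calc Lc ^ j * R + Lc ^ j ≤ k := hk
            _ ≤ Lc ^ k := (Nat.lt_pow_self hLc.2).le
            _ ≤ 2 * Lc ^ k := Nat.le_mul_of_pos_left _ two_pos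
            _ ≤ Lc ^ (j + m) * (2 * Lc ^ k) := Nat.le_mul_of_pos_left _ (by positivity)
        exact_mod_cast this
      exact le_trans (add_le_add_left (mul_le_mul_of_nonneg_left h1 (by positivity)) _) h2
    have h := sum_abs_tsum_unitK_KTot_ff_pshift_rowDiff_le (nP (Pk k)) (one_le_nP (Pk k)) (MP (Pk k)) (Lc ^ j) (Lc ^ m) hMb
      (by rw [hnP, pow_add, mul_comm]) (hC1 (Pk k) rfl rfl hjm) sm x' μ κ l Q hsep
    refine le_of_eq_of_le ?_ h
    refine Finset.sum_congr rfl fun y' _ => ?_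
    rw [tsum_rowDiff_pshift_eq (Lc ^ (j + m)) (Lc ^ j) hMb (hPd1 k) _ sm _ x' y' κ l]
    rfl
  exact sum_abs_le_of_periodisations Q
    (fun y' => (summable_unitK_KTot_ff (Lc ^ (j + m)) (Lc ^ j) hMb _ sm (x' + AffineAveraging.unitVec μ) κ l).sub
      (summable_unitK_KTot_ff (Lc ^ (j + m)) (Lc ^ j) hMb _ sm x' κ l))
    (fun y' => y') hPd1 hPgrow hB

end Finite

/-! ## §3 The road (`d = 3`): the perfect ff block, one coarse unit step in either variable -/

section Road

variable {Lc : ℕ} [NeZero Lc]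

/-- [our object] **(T1′), ROW FORM, CONDITIONAL ON THE TOWER LETTER**: for odd `Lc > 1` and the GRADIENT row-sum letter `C₁∕N` of the hard covariance
on the tower tori (`d = 3`, `a = 1`), for every `m ≥ 1`, finite `Q ⊂ ℤ⁴`, `x′ μ κ l`:
`Σ_{y′∈Q} |KPerf Lc (sfStep Lc) (smStep 3 Lc) m (x′+e_μ) y′ (inl κ) (inl l) − KPerf … m x′ y′ (inl κ) (inl l)| ≤ (C₁∕2)·Lc^m`. -/
theorem sum_abs_KPerf_ff_rowDiff_le (hLc : Odd Lc ∧ 1 < Lc) {C₁ : ℝ}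
    (hC1 : ∀ P : Params, P.d = 3 + 1 → P.L = Lc → 1 ≤ P.K →
      ∀ (i : Tor (fine (nP P) (MP P)) × Fin P.d) (μ : Fin P.d),
        ∑ j, ‖Cov (nP P) (one_le_nP P) (MP P) 1 one_pos (i.1 + B5Prop11Plancherel.unitVec (fine (nP P) (MP P)) μ, i.2) j
          - Cov (nP P) (one_le_nP P) (MP P) 1 one_pos i j‖ ≤ C₁ / (nP P : ℝ))
    {m : ℕ} (hm : 1 ≤ m) (x' : Site (3 + 1)) (μ κ l : Fin (3 + 1)) (Q : Finset (Site (3 + 1))) :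
    ∑ y' ∈ Q, |KPerf (d := 3) Lc (sfStep Lc) (smStep 3 Lc) m (x' + AffineAveraging.unitVec μ) y' (Sum.inl κ) (Sum.inl l)
        - KPerf (d := 3) Lc (sfStep Lc) (smStep 3 Lc) m x' y' (Sum.inl κ) (Sum.inl l)| ≤ C₁ / 2 * (Lc : ℝ) ^ m := by
  have hLc2 : 2 ≤ Lc := hLc.2
  have ht : Tendsto (fun j => ∑ y' ∈ Q,
      |unitK (sfStep Lc j) (smStep 3 Lc j) (KTot (d := 3) (Lc ^ (j + m)) (Lc ^ j)) (x' + AffineAveraging.unitVec μ) y' (Sum.inl κ) (Sum.inl l)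
        - unitK (sfStep Lc j) (smStep 3 Lc j) (KTot (d := 3) (Lc ^ (j + m)) (Lc ^ j)) x' y' (Sum.inl κ) (Sum.inl l)|)
      atTop (𝓝 (∑ y' ∈ Q, |KPerf (d := 3) Lc (sfStep Lc) (smStep 3 Lc) m (x' + AffineAveraging.unitVec μ) y' (Sum.inl κ) (Sum.inl l)
        - KPerf (d := 3) Lc (sfStep Lc) (smStep 3 Lc) m x' y' (Sum.inl κ) (Sum.inl l)|)) :=
    tendsto_finsetSum Q fun y' _ =>
      ((tendsto_KTot_KPerf_holds hLc2 hm (x' + AffineAveraging.unitVec μ) y' (Sum.inl κ) (Sum.inl l)).sub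
        (tendsto_KTot_KPerf_holds hLc2 hm x' y' (Sum.inl κ) (Sum.inl l))).abs
  refine le_of_tendsto' ht fun j => ?_
  have hsf : sfStep Lc j = ((Lc ^ j : ℕ) : ℝ) := by simp [sfStep]
  have hjm : 1 ≤ j + m := by omega
  have h := sum_abs_unitK_KTot_ff_rowDiff_le (d := 3) hLc hC1 j m hjm (smStep 3 Lc j) x' μ κ l Q
  rw [hsf]
  refine h.trans (le_of_eq ?_)
  have hL : (Lc : ℝ) ≠ 0 := by exact_mod_cast (NeZero.ne Lc)
  simp only [legW]
  push_cast
  field_simp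
  ring

/-- [our object] **(T1′), COLUMN FORM = RHOA-3's `hT1` SHAPE AT `v = e_μ`, CONDITIONAL ON THE TOWER LETTER**: for odd `Lc > 1` and the GRADIENT row-sum
letter `C₁∕N` of the hard covariance on the tower tori, for every `m ≥ 1`, finite `Q ⊂ ℤ⁴`, `w μ κ l`:
`Σ_{q∈Q} |KPerf Lc (sfStep Lc) (smStep 3 Lc) m q (w+e_μ) (inl κ) (inl l) − KPerf … m q w (inl κ) (inl l)| ≤ (C₁∕2)·Lc^m`
(the engine `LegRemainderGaugeTerm.abs_rho_sub_right_le` ∕ `abs_rho_sub_sub_le` reads this with `T₁ = (C₁∕2)·n`, `n = Lc^m`). -/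
theorem sum_abs_KPerf_ff_colDiff_le (hLc : Odd Lc ∧ 1 < Lc) {C₁ : ℝ}
    (hC1 : ∀ P : Params, P.d = 3 + 1 → P.L = Lc → 1 ≤ P.K →
      ∀ (i : Tor (fine (nP P) (MP P)) × Fin P.d) (μ : Fin P.d),
        ∑ j, ‖Cov (nP P) (one_le_nP P) (MP P) 1 one_pos (i.1 + B5Prop11Plancherel.unitVec (fine (nP P) (MP P)) μ, i.2) j
          - Cov (nP P) (one_le_nP P) (MP P) 1 one_pos i j‖ ≤ C₁ / (nP P : ℝ))
    {m : ℕ} (hm : 1 ≤ m) (w : Site (3 + 1)) (μ κ l : Fin (3 + 1)) (Q : Finset (Site (3 + 1))) :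
    ∑ q ∈ Q, |KPerf (d := 3) Lc (sfStep Lc) (smStep 3 Lc) m q (w + AffineAveraging.unitVec μ) (Sum.inl κ) (Sum.inl l)
        - KPerf (d := 3) Lc (sfStep Lc) (smStep 3 Lc) m q w (Sum.inl κ) (Sum.inl l)| ≤ C₁ / 2 * (Lc : ℝ) ^ m := by
  have hLc2 : 2 ≤ Lc := hLc.2
  simp_rw [KPerf_ff_symm hLc2 hm _ (w + AffineAveraging.unitVec μ) κ l, KPerf_ff_symm hLc2 hm _ w κ l]
  exact sum_abs_KPerf_ff_rowDiff_le hLc hC1 hm w μ l κ Q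

end Road

end Summit.QuantumFields.BalabanUV.Beta.FP.PerfectFFBlockRowDiff

end
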